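import Summits.Ventures.PercRepro.S1CFGTriangles

/-!
# PercRepro — TOOLS FOR THE TRIANGLE CAP AT `n ≥ 2ν + 1` (p1, gen 39)

Three lemmas split off S1CFGTrianglesTwo (the `400`-line rule):
* `mem_closure_of_eRk_insert_le` — `rk (insert x X) ≤ rk X ⇒ x ∈ cl X`;
* `ncard_le_of_closed` — the count of rank-`2` triples split along a triangle-closed proper `S ⊇ T₀` with `ψ(S) ≤ 1`
  (the tail of S1CFGTriangles' proof as a lemma);
* `mem_closure_pair_of_eRk_insert_le_two` — a rank-`≤ 2` triple `insert x P` with `P` an independent pair puts `x ∈ cl P`.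
Nothing about any cell is claimed. Axioms: standard.
-/

open scoped Matroid

namespace PercRepro

namespace S1CFG

open Set S1CF

variable {α : Type}

/-- If `rk (insert x X) ≤ rk X` (`x ∈ E`, `X ⊆ E`) then `x ∈ cl X`. -/
theorem mem_closure_of_eRk_insert_le (M : Matroid α) [M.Finite] {X : Set α} {x : α} (hX : X ⊆ M.E)
    (hx : x ∈ M.E) (h : M.eRk (insert x X) ≤ M.eRk X) : x ∈ M.closure X := by
  by_contra hxcl
  have h1 := Matroid.eRk_insert_eq_add_one (M := M) (e := x) (X := X) ⟨hx, hxcl⟩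
  rw [h1] at h
  have hfin : M.eRk X ≠ ⊤ := ((M.eRk_le_encard X).trans_lt (M.ground_finite.subset hX).encard_lt_top).ne
  exact absurd h (not_le.mpr ((ENat.lt_add_one_iff hfin).mpr le_rfl))

/-- The count of rank-`2` triples, split along a triangle-closed proper subset `S ⊇ T₀` with `ψ(S) ≤ 1`
(the tail of S1CFGTriangles' proof as a lemma). -/
theorem ncard_le_of_closed (M : Matroid α) [M.Finite] {ν : ℕ}
    (hd : M.E.encard = M.eRank + (ν : ℕ∞)) (hK : ∀ e, ¬ M.IsColoop e)
    (h0 : {P : Set α | P ⊆ M.E ∧ P.ncard = 2 ∧ M.Dep P}.ncard = 0) {S T₀ : Set α} (hSE : S ⊆ M.E)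
    (hT₀S : T₀ ⊆ S) (hT₀3 : T₀.ncard = 3) (hT₀r : M.eRk T₀ ≤ 2) (hSne : S ≠ M.E)
    (hclosed : ∀ X, X ⊆ M.E → X.ncard = 3 → M.eRk X ≤ 2 → (S ∩ X).Nonempty → X ⊆ S) :
    {X : Set α | X ⊆ M.E ∧ X.ncard = 3 ∧ M.eRk X ≤ 2}.ncard ≤ (ν + 1).choose 3 + 1 := by
  classical
  have hEfin := M.ground_finite
  have hSfin : S.Finite := hEfin.subset hSE
  have hnE := ncard_ground_eq_eRk_toNat_add M hd
  have hsplit : {X : Set α | X ⊆ M.E ∧ X.ncard = 3 ∧ M.eRk X ≤ 2} ⊆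
      {X : Set α | X ⊆ S ∧ X.ncard = 3 ∧ M.eRk X ≤ 2} ∪
      {X : Set α | X ⊆ M.E \ S ∧ X.ncard = 3 ∧ M.eRk X ≤ 2} := by
    intro X hX
    obtain ⟨hXE, hX3, hXr⟩ := hX
    rcases (S ∩ X).eq_empty_or_nonempty with hSX | hSX
    · right
      refine ⟨fun x hx => ⟨hXE hx, fun hxS => ?_⟩, hX3, hXr⟩
      have : x ∈ S ∩ X := ⟨hxS, hx⟩
      rw [hSX] at this
      exact this
    · left
      exact ⟨hclosed X hXE hX3 hXr hSX, hX3, hXr⟩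
  have hcount : {X : Set α | X ⊆ M.E ∧ X.ncard = 3 ∧ M.eRk X ≤ 2}.ncard ≤
      {X : Set α | X ⊆ S ∧ X.ncard = 3 ∧ M.eRk X ≤ 2}.ncard +
      {X : Set α | X ⊆ M.E \ S ∧ X.ncard = 3 ∧ M.eRk X ≤ 2}.ncard := by
    refine (Set.ncard_le_ncard hsplit ?_).trans (Set.ncard_union_le _ _)
    exact (hEfin.finite_subsets.subset (fun X hX => hX.1.trans hSE)).union
      (hEfin.finite_subsets.subset (fun X hX => hX.1.trans sdiff_subset))
  have hcapS := ncard_three_eRk_le_two_le_of_no_dep_pair_restrict M h0 hSE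
  have hcapC := ncard_three_eRk_le_two_le_of_no_dep_pair_restrict M h0 (sdiff_subset : M.E \ S ⊆ M.E)
  have hrkS : (M.eRk S).toNat ≤ S.ncard := by
    have := M.eRk_le_encard S
    rw [← S1.coe_toNat_eRk M hSE, ← hSfin.cast_ncard_eq] at this
    exact_mod_cast this
  have hT₀r' : (M.eRk T₀).toNat ≤ 2 := by
    rw [← S1.coe_toNat_eRk M (hT₀S.trans hSE)] at hT₀r
    exact_mod_cast hT₀r
  have ha1 : (M.eRk S).toNat + 1 ≤ S.ncard := by
    have := ncard_add_eRk_le_of_subset M hSE hT₀S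
    omega
  have haν : S.ncard + 1 ≤ (M.eRk S).toNat + ν :=
    ncard_add_one_le_eRk_toNat_add_of_ssubset M hd hK hSE hSne
  have hCfin : (M.E \ S).Finite := hEfin.subset sdiff_subset
  have hrkC : (M.eRk (M.E \ S)).toNat ≤ (M.E \ S).ncard := by
    have := M.eRk_le_encard (M.E \ S)
    rw [← S1.coe_toNat_eRk M sdiff_subset, ← hCfin.cast_ncard_eq] at this
    exact_mod_cast this
  have hsubadd : (M.eRk M.E).toNat ≤ (M.eRk S).toNat + (M.eRk (M.E \ S)).toNat := by
    have := M.eRk_union_le_eRk_add_eRk S (M.E \ S)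
    rw [union_sdiff_cancel hSE, ← S1.coe_toNat_eRk M (subset_refl M.E), ← S1.coe_toNat_eRk M hSE,
      ← S1.coe_toNat_eRk M sdiff_subset] at this
    exact_mod_cast this
  have hcardsplit := Set.ncard_sdiff_add_ncard_of_subset hSE hEfin
  have hfinal := choose_add_choose_le_of_add_le (a := S.ncard - (M.eRk S).toNat)
    (b := (M.E \ S).ncard - (M.eRk (M.E \ S)).toNat) (ν := ν) (by omega) (by omega) (by omega)
  calc {X : Set α | X ⊆ M.E ∧ X.ncard = 3 ∧ M.eRk X ≤ 2}.ncard ≤ _ := hcount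
    _ ≤ (S.ncard - (M.eRk S).toNat + 2).choose 3 +
        ((M.E \ S).ncard - (M.eRk (M.E \ S)).toNat + 2).choose 3 := Nat.add_le_add hcapS hcapC
    _ ≤ (ν + 1).choose 3 + 1 := hfinal

/-- A rank-`≤ 2` triple `Y = insert x P` with `P` an independent pair puts `x` in `cl P`. -/
theorem mem_closure_pair_of_eRk_insert_le_two (M : Matroid α) [M.Finite] {P : Set α} {x : α}
    (hP : P ⊆ M.E) (hPind : M.Indep P) (hP2 : P.ncard = 2) (hx : x ∈ M.E)
    (hr : M.eRk (insert x P) ≤ 2) : x ∈ M.closure P := by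
  apply mem_closure_of_eRk_insert_le M hP hx
  have hPfin : P.Finite := M.ground_finite.subset hP
  rw [hPind.eRk_eq_encard, ← hPfin.cast_ncard_eq, hP2]
  exact hr

end S1CFG

end PercRepro
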